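import Mathlib.MeasureTheory.Function.ConditionalExpectation.Real
import Mathlib.MeasureTheory.Function.ConditionalExpectation.PullOut
import Mathlib.Dynamics.Ergodic.MeasurePreserving
import HarnessLib

/-!
# Crux `NT` / seam `UVSeamRec.stub_floorsEngine` (S-B), residual MF: the MIRROR σ-SPLIT and the RP LOCALISER,
# abstract probability layer (card `block-sigma-algebra-mirror-split`, kernel-checked in the tree)

Helper file (`--supports stmt-QuantumFields-20043`; owner RULINGS R78/R87) of the fleet lead `ym-spine-19353-p1`.
WHICH CLAUSE IT SUPPLIES (through its torus sequel `…NTMirrorSplitTorus`): the bare lattice mirror floor **MF(4ε)**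
`4ε ≤ Cov_T(Ṽ_v∘Θ₀, Ṽ_v)` — the R87 residual of record of conjunct 2 (two-point floor) of the REGISTERED
`UVSeamRec.stub_floorsEngine` (consumed by p517197 / p518416) — split EXACTLY along a reflection-invariant
sub-σ-algebra `m` (the card pins `m` to the σ-algebra of Bałaban's last-scale block field; here `m` is a PARAMETER)
and floored by RP localisation.

WHAT IS PROVED (abstract probability: `μ` a probability measure, `Θ` a measure-preserving measurable involution, `m`
a `Θ`-invariant sub-σ-algebra, `X = μ[f|m]`, `Cov(A, B) := ∫ A·B − ∫A ∫B`):
* `mirror_split` — the law of total covariance for the MIRROR pair,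
  `Cov(f∘Θ, f) = Cov(X∘Θ, X) + ∫ (f∘Θ − X∘Θ)(f − X) dμ`;
* `mirror_split_localiser` — for ANY bounded `m`-measurable `h`,
  `Cov(f∘Θ, f) = Cov(h∘Θ, h) + 2·Cov(h∘Θ, X − h) + [∫ (f∘Θ − h∘Θ)(f − h) − (∫ (f − h))²]`;
* `mirror_floor_of_localiser` — if `∫ h = ∫ f` and the bracket is `≥ 0` (reflection positivity), then
  `Cov(f∘Θ, f) ≥ Cov(h∘Θ, h) − 2·|Cov(h∘Θ, X − h)|`;
* `two_abs_cov_comp_le` — `2·|Cov(h∘Θ, D)| ≤ t·Var h + t⁻¹·∫ D²` (weighted Cauchy–Schwarz: the localisation cross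
  term is controlled by ONE variance and ONE mean-square localisation error);
* σ-algebra tools `measurable_sup_comap_invol` (ANY `m ⊔ Θ^*m` is `Θ`-invariant), `sup_comap_le`,
  `measurable_comap_of_equivariant` (`π∘Θ = θ∘π` ⇒ `σ(π)` is `Θ`-invariant).

HONEST FRAMING.  Identities/inequalities of abstract probability; the engine-grade content ((LMF) for a pinned
block-field localiser, (LXB) one-observable quasi-locality of Bałaban conditional expectations) is OPEN and is not
asserted here.  Nothing about NT, the seam or a mass gap. [cite: GlimmJaffe1987, §6.1; OsterwalderSeiler1978, §2]
-/

set_option autoImplicit false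

noncomputable section

open MeasureTheory Filter Topology

namespace Summit.QuantumFields.YangMills.Cruxes.NT.MirrorSplit

/-! ## §1 The abstract mirror split over a reflection-invariant σ-algebra -/

section Abstract

variable {Ω : Type*}

/-- **Symmetrisation.**  For ANY σ-algebra `m` and any involution `Θ`, the σ-algebra `m ⊔ Θ^* m` is `Θ`-invariant
(`Θ` is measurable from it to itself). [folklore] -/
theorem measurable_sup_comap_invol (m : MeasurableSpace Ω) (Θ : Ω → Ω) (hΘΘ : ∀ ω, Θ (Θ ω) = ω) :
    Measurable[m ⊔ m.comap Θ, m ⊔ m.comap Θ] Θ := by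
  rw [measurable_iff_comap_le, MeasurableSpace.comap_sup, MeasurableSpace.comap_comp]
  have hid : Θ ∘ Θ = id := funext hΘΘ
  rw [hid, MeasurableSpace.comap_id]
  exact le_of_eq (sup_comm _ _)

/-- The symmetrised σ-algebra of a sub-σ-algebra is a sub-σ-algebra. [folklore] -/
theorem sup_comap_le {m m₀ : MeasurableSpace Ω} (hm : m ≤ m₀) {Θ : Ω → Ω} (hΘ : Measurable[m₀, m₀] Θ) :
    m ⊔ m.comap Θ ≤ m₀ :=
  sup_le hm ((MeasurableSpace.comap_mono hm).trans hΘ.comap_le)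

/-- **Equivariance ⇒ invariance.**  If `π ∘ Θ = θ ∘ π` with `θ` measurable, the σ-algebra generated by `π` is
`Θ`-invariant. [folklore] -/
theorem measurable_comap_of_equivariant {Y : Type*} [MeasurableSpace Y] (π : Ω → Y) (Θ : Ω → Ω) (θ : Y → Y)
    (hθ : Measurable θ) (h : ∀ ω, π (Θ ω) = θ (π ω)) :
    Measurable[MeasurableSpace.comap π inferInstance, MeasurableSpace.comap π inferInstance] Θ := by
  rw [measurable_iff_comap_le, MeasurableSpace.comap_comp]
  have hc : π ∘ Θ = θ ∘ π := funext h
  rw [hc, ← MeasurableSpace.comap_comp]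
  exact MeasurableSpace.comap_mono hθ.comap_le

/-- Integrability of a product with an a.e.-bounded right factor. [folklore] -/
theorem integrable_mul_of_bdd_right [MeasurableSpace Ω] {μ : Measure Ω} {X Y : Ω → ℝ} {M : ℝ}
    (hX : Integrable X μ) (hY : AEStronglyMeasurable Y μ) (hYb : ∀ᵐ ω ∂μ, |Y ω| ≤ M) :
    Integrable (fun ω => X ω * Y ω) μ := by
  have h := hX.bdd_mul hY (hYb.mono fun ω h => by rw [Real.norm_eq_abs]; exact h)
  simpa only [mul_comm] using h

/-- **The mirror split (law of total covariance for a mirror pair).**  `μ` a probability measure, `Θ` a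
measure-preserving measurable involution, `m` a `Θ`-invariant sub-σ-algebra, `f` bounded measurable, `X := μ[f|m]`:
`Cov(f∘Θ, f) = Cov(X∘Θ, X) + ∫ (f∘Θ − X∘Θ)(f − X) dμ`, with `Cov(A, B) := ∫ A·B − ∫A ∫B`.
Proof: pull-out (`X∘Θ` is `m`-measurable, so `∫ (X∘Θ)·f = ∫ (X∘Θ)·X`) and the change of variables `ω ↦ Θω`
(`∫ (f∘Θ)·X = ∫ f·(X∘Θ)`). [cite: GlimmJaffe1987, §6.1] -/
theorem mirror_split {m mΩ : MeasurableSpace Ω} (μ : Measure Ω) [IsProbabilityMeasure μ] (hm : m ≤ mΩ)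
    {Θ : Ω → Ω} (hΘμ : MeasurePreserving Θ μ μ) (hΘΘ : ∀ ω, Θ (Θ ω) = ω) (hΘm : Measurable[m, m] Θ)
    {f : Ω → ℝ} (hf : Measurable f) {M : ℝ} (hM : ∀ ω, |f ω| ≤ M) :
    (∫ ω, f (Θ ω) * f ω ∂μ) - (∫ ω, f (Θ ω) ∂μ) * (∫ ω, f ω ∂μ) =
      ((∫ ω, (μ[f|m]) (Θ ω) * (μ[f|m]) ω ∂μ) - (∫ ω, (μ[f|m]) (Θ ω) ∂μ) * (∫ ω, (μ[f|m]) ω ∂μ)) +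
        ∫ ω, (f (Θ ω) - (μ[f|m]) (Θ ω)) * (f ω - (μ[f|m]) ω) ∂μ := by
  set X : Ω → ℝ := μ[f|m] with hXdef
  have hΘ : Measurable Θ := hΘμ.measurable
  have hemb : MeasurableEmbedding Θ := (MeasurableEquiv.ofInvolutive Θ hΘΘ hΘ).measurableEmbedding
  have hsub : ∀ g : Ω → ℝ, ∫ ω, g (Θ ω) ∂μ = ∫ ω, g ω ∂μ := fun g => hΘμ.integral_comp hemb g
  -- integrability and bounds
  have hfi : Integrable f μ := (integrable_const M).mono' hf.aestronglyMeasurable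
    (Eventually.of_forall fun ω => by rw [Real.norm_eq_abs]; exact hM ω)
  have hfΘm : Measurable fun ω => f (Θ ω) := hf.comp hΘ
  have hfΘi : Integrable (fun ω => f (Θ ω)) μ := (integrable_const M).mono' hfΘm.aestronglyMeasurable
    (Eventually.of_forall fun ω => by rw [Real.norm_eq_abs]; exact hM _)
  have hXi : Integrable X μ := integrable_condExp
  have hXb : ∀ᵐ ω ∂μ, |X ω| ≤ M := ae_bdd_abs_condExp_of_ae_bdd_abs (Eventually.of_forall hM)
  have hXΘi : Integrable (fun ω => X (Θ ω)) μ := (hΘμ.integrable_comp_emb hemb).2 hXi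
  have hfb : ∀ᵐ ω ∂μ, |f ω| ≤ M := Eventually.of_forall hM
  have hfΘf : Integrable (fun ω => f (Θ ω) * f ω) μ :=
    integrable_mul_of_bdd_right hfΘi hf.aestronglyMeasurable hfb
  have hfΘX : Integrable (fun ω => f (Θ ω) * X ω) μ := integrable_mul_of_bdd_right hfΘi hXi.1 hXb
  have hXΘf : Integrable (fun ω => X (Θ ω) * f ω) μ :=
    integrable_mul_of_bdd_right hXΘi hf.aestronglyMeasurable hfb
  have hXΘX : Integrable (fun ω => X (Θ ω) * X ω) μ := integrable_mul_of_bdd_right hXΘi hXi.1 hXb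
  -- the reflected conditional expectation is `m`-measurable
  have hXsm : StronglyMeasurable[m] X := stronglyMeasurable_condExp
  have hXΘsm : StronglyMeasurable[m] (fun ω => X (Θ ω)) := hXsm.comp_measurable hΘm
  -- means
  have iX : ∫ ω, X ω ∂μ = ∫ ω, f ω ∂μ := integral_condExp hm
  have ifΘ : ∫ ω, f (Θ ω) ∂μ = ∫ ω, f ω ∂μ := hsub f
  have iXΘ : ∫ ω, X (Θ ω) ∂μ = ∫ ω, f ω ∂μ := (hsub X).trans iX
  -- pull-out: ∫ (X∘Θ)·f = ∫ (X∘Θ)·X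
  have iXΘf : ∫ ω, X (Θ ω) * f ω ∂μ = ∫ ω, X (Θ ω) * X ω ∂μ := by
    have hprod : Integrable ((fun ω => X (Θ ω)) * f) μ := hXΘf
    have hpull : μ[(fun ω => X (Θ ω)) * f|m] =ᵐ[μ] (fun ω => X (Θ ω)) * μ[f|m] :=
      condExp_mul_of_stronglyMeasurable_left hXΘsm hprod hfi
    calc ∫ ω, X (Θ ω) * f ω ∂μ = ∫ ω, ((fun ω => X (Θ ω)) * f) ω ∂μ := rfl
      _ = ∫ ω, (μ[(fun ω => X (Θ ω)) * f|m]) ω ∂μ := (integral_condExp hm).symm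
      _ = ∫ ω, ((fun ω => X (Θ ω)) * μ[f|m]) ω ∂μ := integral_congr_ae hpull
      _ = ∫ ω, X (Θ ω) * X ω ∂μ := rfl
  -- change of variables: ∫ (f∘Θ)·X = ∫ f·(X∘Θ) = ∫ (X∘Θ)·X
  have ifΘX : ∫ ω, f (Θ ω) * X ω ∂μ = ∫ ω, X (Θ ω) * X ω ∂μ := by
    have h1 := hsub (fun ω => f ω * X (Θ ω))
    simp only [hΘΘ] at h1
    rw [h1]
    have h2 : (fun ω => f ω * X (Θ ω)) = fun ω => X (Θ ω) * f ω := by funext ω; ring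
    rw [h2, iXΘf]
  -- expand the noise term
  have hnoise : ∫ ω, (f (Θ ω) - X (Θ ω)) * (f ω - X ω) ∂μ =
      (∫ ω, f (Θ ω) * f ω ∂μ) - (∫ ω, f (Θ ω) * X ω ∂μ) - (∫ ω, X (Θ ω) * f ω ∂μ)
        + ∫ ω, X (Θ ω) * X ω ∂μ := by
    have e : (fun ω => (f (Θ ω) - X (Θ ω)) * (f ω - X ω)) =
        fun ω => f (Θ ω) * f ω - f (Θ ω) * X ω - X (Θ ω) * f ω + X (Θ ω) * X ω := by
      funext ω; ring
    have h1 : Integrable (fun ω => f (Θ ω) * f ω - f (Θ ω) * X ω) μ := hfΘf.sub hfΘX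
    have h2 : Integrable (fun ω => f (Θ ω) * f ω - f (Θ ω) * X ω - X (Θ ω) * f ω) μ := h1.sub hXΘf
    rw [e, integral_add h2 hXΘX, integral_sub h1 hXΘf, integral_sub hfΘf hfΘX]
  rw [hnoise, ifΘX, iXΘf, ifΘ, iXΘ, iX]
  ring

/-- **The localised mirror split.**  `μ` a probability measure, `Θ` a measure-preserving measurable involution, `m` a
`Θ`-invariant sub-σ-algebra, `f` bounded measurable, `X := μ[f|m]`, `h` ANY bounded `m`-measurable function:
`Cov(f∘Θ, f) = Cov(h∘Θ, h) + 2·Cov(h∘Θ, X − h) + (∫ (f∘Θ − h∘Θ)(f − h) − (∫ (f − h))²)`.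
(`h = X` is `mirror_split`.) [cite: GlimmJaffe1987, §6.1] -/
theorem mirror_split_localiser {m mΩ : MeasurableSpace Ω} (μ : Measure Ω) [IsProbabilityMeasure μ] (hm : m ≤ mΩ)
    {Θ : Ω → Ω} (hΘμ : MeasurePreserving Θ μ μ) (hΘΘ : ∀ ω, Θ (Θ ω) = ω) (hΘm : Measurable[m, m] Θ)
    {f : Ω → ℝ} (hf : Measurable f) {M : ℝ} (hM : ∀ ω, |f ω| ≤ M)
    {h : Ω → ℝ} (hh : Measurable[m] h) {K : ℝ} (hK : ∀ ω, |h ω| ≤ K) :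
    (∫ ω, f (Θ ω) * f ω ∂μ) - (∫ ω, f (Θ ω) ∂μ) * (∫ ω, f ω ∂μ) =
      ((∫ ω, h (Θ ω) * h ω ∂μ) - (∫ ω, h (Θ ω) ∂μ) * (∫ ω, h ω ∂μ)) +
        2 * ((∫ ω, h (Θ ω) * ((μ[f|m]) ω - h ω) ∂μ) -
          (∫ ω, h (Θ ω) ∂μ) * (∫ ω, ((μ[f|m]) ω - h ω) ∂μ)) +
        ((∫ ω, (f (Θ ω) - h (Θ ω)) * (f ω - h ω) ∂μ) - (∫ ω, (f ω - h ω) ∂μ) ^ 2) := by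
  set X : Ω → ℝ := μ[f|m] with hXdef
  have hΘ : Measurable Θ := hΘμ.measurable
  have hemb : MeasurableEmbedding Θ := (MeasurableEquiv.ofInvolutive Θ hΘΘ hΘ).measurableEmbedding
  have hsub : ∀ g : Ω → ℝ, ∫ ω, g (Θ ω) ∂μ = ∫ ω, g ω ∂μ := fun g => hΘμ.integral_comp hemb g
  have hhm : Measurable h := hh.mono hm le_rfl
  have hhΘm' : Measurable[m] (fun ω => h (Θ ω)) := hh.comp hΘm
  have hhΘm : Measurable (fun ω => h (Θ ω)) := hhm.comp hΘ
  -- integrability and bounds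
  have bdd : ∀ {g : Ω → ℝ}, Measurable g → ∀ {C : ℝ}, (∀ ω, |g ω| ≤ C) → Integrable g μ :=
    fun hg C hC => (integrable_const C).mono' hg.aestronglyMeasurable
      (Eventually.of_forall fun ω => by rw [Real.norm_eq_abs]; exact hC ω)
  have hfi : Integrable f μ := bdd hf hM
  have hfΘm : Measurable fun ω => f (Θ ω) := hf.comp hΘ
  have hfΘi : Integrable (fun ω => f (Θ ω)) μ := bdd hfΘm fun ω => hM _
  have hhi : Integrable h μ := bdd hhm hK
  have hhΘi : Integrable (fun ω => h (Θ ω)) μ := bdd hhΘm fun ω => hK _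
  have hXi : Integrable X μ := integrable_condExp
  have hXb : ∀ᵐ ω ∂μ, |X ω| ≤ M := ae_bdd_abs_condExp_of_ae_bdd_abs (Eventually.of_forall hM)
  have hfb : ∀ᵐ ω ∂μ, |f ω| ≤ M := Eventually.of_forall hM
  have hhb : ∀ᵐ ω ∂μ, |h ω| ≤ K := Eventually.of_forall hK
  have hfΘf : Integrable (fun ω => f (Θ ω) * f ω) μ :=
    integrable_mul_of_bdd_right hfΘi hf.aestronglyMeasurable hfb
  have hfΘh : Integrable (fun ω => f (Θ ω) * h ω) μ :=
    integrable_mul_of_bdd_right hfΘi hhm.aestronglyMeasurable hhb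
  have hhΘf : Integrable (fun ω => h (Θ ω) * f ω) μ :=
    integrable_mul_of_bdd_right hhΘi hf.aestronglyMeasurable hfb
  have hhΘh : Integrable (fun ω => h (Θ ω) * h ω) μ :=
    integrable_mul_of_bdd_right hhΘi hhm.aestronglyMeasurable hhb
  have hhΘX : Integrable (fun ω => h (Θ ω) * X ω) μ := integrable_mul_of_bdd_right hhΘi hXi.1 hXb
  -- means
  have iX : ∫ ω, X ω ∂μ = ∫ ω, f ω ∂μ := integral_condExp hm
  have ifΘ : ∫ ω, f (Θ ω) ∂μ = ∫ ω, f ω ∂μ := hsub f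
  have ihΘ : ∫ ω, h (Θ ω) ∂μ = ∫ ω, h ω ∂μ := hsub h
  -- pull-out: ∫ (h∘Θ)·f = ∫ (h∘Θ)·X  (`h∘Θ` is `m`-measurable since `m` is `Θ`-invariant)
  have hhΘsm : StronglyMeasurable[m] (fun ω => h (Θ ω)) := hhΘm'.stronglyMeasurable
  have ihΘf : ∫ ω, h (Θ ω) * f ω ∂μ = ∫ ω, h (Θ ω) * X ω ∂μ := by
    have hpull : μ[(fun ω => h (Θ ω)) * f|m] =ᵐ[μ] (fun ω => h (Θ ω)) * μ[f|m] :=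
      condExp_mul_of_stronglyMeasurable_left hhΘsm hhΘf hfi
    calc ∫ ω, h (Θ ω) * f ω ∂μ = ∫ ω, ((fun ω => h (Θ ω)) * f) ω ∂μ := rfl
      _ = ∫ ω, (μ[(fun ω => h (Θ ω)) * f|m]) ω ∂μ := (integral_condExp hm).symm
      _ = ∫ ω, ((fun ω => h (Θ ω)) * μ[f|m]) ω ∂μ := integral_congr_ae hpull
      _ = ∫ ω, h (Θ ω) * X ω ∂μ := rfl
  -- change of variables: ∫ (f∘Θ)·h = ∫ f·(h∘Θ) = ∫ (h∘Θ)·X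
  have ifΘh : ∫ ω, f (Θ ω) * h ω ∂μ = ∫ ω, h (Θ ω) * X ω ∂μ := by
    have h1 := hsub (fun ω => f ω * h (Θ ω))
    simp only [hΘΘ] at h1
    rw [h1]
    have h2 : (fun ω => f ω * h (Θ ω)) = fun ω => h (Θ ω) * f ω := by funext ω; ring
    rw [h2, ihΘf]
  -- expansions
  have e1 : ∫ ω, h (Θ ω) * (X ω - h ω) ∂μ = (∫ ω, h (Θ ω) * X ω ∂μ) - ∫ ω, h (Θ ω) * h ω ∂μ := by
    have e : (fun ω => h (Θ ω) * (X ω - h ω)) = fun ω => h (Θ ω) * X ω - h (Θ ω) * h ω := by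
      funext ω; ring
    rw [e, integral_sub hhΘX hhΘh]
  have e2 : ∫ ω, (X ω - h ω) ∂μ = (∫ ω, X ω ∂μ) - ∫ ω, h ω ∂μ := integral_sub hXi hhi
  have e3 : ∫ ω, (f ω - h ω) ∂μ = (∫ ω, f ω ∂μ) - ∫ ω, h ω ∂μ := integral_sub hfi hhi
  have e4 : ∫ ω, (f (Θ ω) - h (Θ ω)) * (f ω - h ω) ∂μ =
      (∫ ω, f (Θ ω) * f ω ∂μ) - (∫ ω, f (Θ ω) * h ω ∂μ) - (∫ ω, h (Θ ω) * f ω ∂μ)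
        + ∫ ω, h (Θ ω) * h ω ∂μ := by
    have e : (fun ω => (f (Θ ω) - h (Θ ω)) * (f ω - h ω)) =
        fun ω => f (Θ ω) * f ω - f (Θ ω) * h ω - h (Θ ω) * f ω + h (Θ ω) * h ω := by
      funext ω; ring
    have h1 : Integrable (fun ω => f (Θ ω) * f ω - f (Θ ω) * h ω) μ := hfΘf.sub hfΘh
    have h2 : Integrable (fun ω => f (Θ ω) * f ω - f (Θ ω) * h ω - h (Θ ω) * f ω) μ := h1.sub hhΘf
    rw [e, integral_add h2 hhΘh, integral_sub h1 hhΘf, integral_sub hfΘf hfΘh]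
  rw [e1, e2, e3, e4, ifΘh, ihΘf, ifΘ, ihΘ, iX]
  ring

/-- **Mirror floor by RP localisation.**  With `∫ h = ∫ f` (centring) and the reflection-positivity hypothesis
`0 ≤ ∫ (f∘Θ − h∘Θ)(f − h)` (on the torus: `f − h` an observable of the closed positive half):
`Cov(f∘Θ, f) ≥ Cov(h∘Θ, h) − 2·|Cov(h∘Θ, X − h)|`, `X = μ[f|m]`. [cite: OsterwalderSeiler1978, §2] -/
theorem mirror_floor_of_localiser {m mΩ : MeasurableSpace Ω} (μ : Measure Ω) [IsProbabilityMeasure μ]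
    (hm : m ≤ mΩ) {Θ : Ω → Ω} (hΘμ : MeasurePreserving Θ μ μ) (hΘΘ : ∀ ω, Θ (Θ ω) = ω)
    (hΘm : Measurable[m, m] Θ) {f : Ω → ℝ} (hf : Measurable f) {M : ℝ} (hM : ∀ ω, |f ω| ≤ M)
    {h : Ω → ℝ} (hh : Measurable[m] h) {K : ℝ} (hK : ∀ ω, |h ω| ≤ K)
    (hcent : ∫ ω, h ω ∂μ = ∫ ω, f ω ∂μ) (hRP : 0 ≤ ∫ ω, (f (Θ ω) - h (Θ ω)) * (f ω - h ω) ∂μ) :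
    ((∫ ω, h (Θ ω) * h ω ∂μ) - (∫ ω, h (Θ ω) ∂μ) * (∫ ω, h ω ∂μ)) -
        2 * |(∫ ω, h (Θ ω) * ((μ[f|m]) ω - h ω) ∂μ) -
          (∫ ω, h (Θ ω) ∂μ) * (∫ ω, ((μ[f|m]) ω - h ω) ∂μ)| ≤
      (∫ ω, f (Θ ω) * f ω ∂μ) - (∫ ω, f (Θ ω) ∂μ) * (∫ ω, f ω ∂μ) := by
  have key := mirror_split_localiser μ hm hΘμ hΘΘ hΘm hf hM hh hK
  have hfi : Integrable f μ := (integrable_const M).mono' hf.aestronglyMeasurable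
    (Eventually.of_forall fun ω => by rw [Real.norm_eq_abs]; exact hM ω)
  have hhi : Integrable h μ := (integrable_const K).mono' (hh.mono hm le_rfl).aestronglyMeasurable
    (Eventually.of_forall fun ω => by rw [Real.norm_eq_abs]; exact hK ω)
  have e3 : ∫ ω, (f ω - h ω) ∂μ = 0 := by rw [integral_sub hfi hhi, hcent, sub_self]
  rw [e3] at key
  have habs := neg_abs_le ((∫ ω, h (Θ ω) * ((μ[f|m]) ω - h ω) ∂μ) -
    (∫ ω, h (Θ ω) ∂μ) * (∫ ω, ((μ[f|m]) ω - h ω) ∂μ))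
  nlinarith [key, habs, hRP]

/-- Pointwise weighted AM–GM: `2|ab| ≤ t a² + b²/t` for `t > 0`. [folklore] -/
theorem two_abs_mul_le (a b : ℝ) {t : ℝ} (ht : 0 < t) : 2 * |a * b| ≤ t * a ^ 2 + t⁻¹ * b ^ 2 := by
  have key : 0 ≤ (t * |a| - |b|) ^ 2 := sq_nonneg _
  have e : t * (t * a ^ 2 + t⁻¹ * b ^ 2 - 2 * |a * b|) = (t * |a| - |b|) ^ 2 := by
    rw [abs_mul]; field_simp; rw [← sq_abs a, ← sq_abs b]; ring
  have : 0 ≤ t * (t * a ^ 2 + t⁻¹ * b ^ 2 - 2 * |a * b|) := by rw [e]; exact key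
  nlinarith [this, ht]

/-- **Cross-covariance bound (weighted Cauchy–Schwarz).**  `μ` a probability measure, `Θ` a measure-preserving
measurable involution, `h` bounded measurable, `D` a.e. bounded: for every `t > 0`,
`2·|Cov(h∘Θ, D)| ≤ t·Var(h) + t⁻¹·∫ D²` (`Var(h) = ∫ h² − (∫h)²`).  Used with `D = g − h`: the localisation
cross term (LXB) is controlled by ONE variance and ONE mean-square localisation error — no two-point input.
[folklore] -/
theorem two_abs_cov_comp_le [MeasurableSpace Ω] (μ : Measure Ω) [IsProbabilityMeasure μ]
    {Θ : Ω → Ω} (hΘμ : MeasurePreserving Θ μ μ) (hΘΘ : ∀ ω, Θ (Θ ω) = ω)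
    {h : Ω → ℝ} (hh : Measurable h) {K : ℝ} (hK : ∀ ω, |h ω| ≤ K)
    {D : Ω → ℝ} (hD : AEStronglyMeasurable D μ) {R : ℝ} (hR : ∀ᵐ ω ∂μ, |D ω| ≤ R) {t : ℝ} (ht : 0 < t) :
    2 * |(∫ ω, h (Θ ω) * D ω ∂μ) - (∫ ω, h (Θ ω) ∂μ) * (∫ ω, D ω ∂μ)| ≤
      t * ((∫ ω, h ω * h ω ∂μ) - (∫ ω, h ω ∂μ) * (∫ ω, h ω ∂μ)) + t⁻¹ * ∫ ω, D ω ^ 2 ∂μ := by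
  have hΘ : Measurable Θ := hΘμ.measurable
  have hemb : MeasurableEmbedding Θ := (MeasurableEquiv.ofInvolutive Θ hΘΘ hΘ).measurableEmbedding
  have hsub : ∀ g : Ω → ℝ, ∫ ω, g (Θ ω) ∂μ = ∫ ω, g ω ∂μ := fun g => hΘμ.integral_comp hemb g
  set mh : ℝ := ∫ ω, h ω ∂μ with hmh
  set mD : ℝ := ∫ ω, D ω ∂μ with hmD
  -- integrability
  have hhi : Integrable h μ := (integrable_const K).mono' hh.aestronglyMeasurable
    (Eventually.of_forall fun ω => by rw [Real.norm_eq_abs]; exact hK ω)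
  have hhΘm : Measurable fun ω => h (Θ ω) := hh.comp hΘ
  have hhΘi : Integrable (fun ω => h (Θ ω)) μ := (integrable_const K).mono' hhΘm.aestronglyMeasurable
    (Eventually.of_forall fun ω => by rw [Real.norm_eq_abs]; exact hK _)
  have hDi : Integrable D μ :=
    (integrable_const R).mono' hD (hR.mono fun ω h => by rw [Real.norm_eq_abs]; exact h)
  -- centred versions
  have hcKΘ : ∀ ω, |h (Θ ω) - mh| ≤ K + |mh| := fun ω => by
    have := abs_sub (h (Θ ω)) mh; linarith [hK (Θ ω)]
  have hcR : ∀ᵐ ω ∂μ, |D ω - mD| ≤ R + |mD| := hR.mono fun ω hω => by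
    have := abs_sub (D ω) mD; linarith
  have hcΘi : Integrable (fun ω => h (Θ ω) - mh) μ := hhΘi.sub (integrable_const _)
  have hcDi : Integrable (fun ω => D ω - mD) μ := hDi.sub (integrable_const _)
  -- (1) cov(h∘Θ, D) = ∫ (h∘Θ − mh)(D − mD)
  have ihΘ : ∫ ω, h (Θ ω) ∂μ = mh := hsub h
  have i1 : Integrable (fun ω => h (Θ ω) * D ω) μ := by
    have := integrable_mul_of_bdd_right hDi hhΘm.aestronglyMeasurable (Eventually.of_forall fun ω => hK (Θ ω))
    simpa only [mul_comm] using this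
  have e1 : (∫ ω, h (Θ ω) * D ω ∂μ) - (∫ ω, h (Θ ω) ∂μ) * (∫ ω, D ω ∂μ) =
      ∫ ω, (h (Θ ω) - mh) * (D ω - mD) ∂μ := by
    have ex : (fun ω => (h (Θ ω) - mh) * (D ω - mD)) =
        fun ω => h (Θ ω) * D ω - mD * h (Θ ω) - mh * D ω + mh * mD := by funext ω; ring
    have i2 : Integrable (fun ω => h (Θ ω) * D ω - mD * h (Θ ω)) μ := i1.sub (hhΘi.const_mul mD)
    have i3 : Integrable (fun ω => h (Θ ω) * D ω - mD * h (Θ ω) - mh * D ω) μ := i2.sub (hDi.const_mul mh)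
    rw [ex, integral_add i3 (integrable_const _), integral_sub i2 (hDi.const_mul mh),
      integral_sub i1 (hhΘi.const_mul mD), integral_const_mul, integral_const_mul, ihΘ, integral_const]
    simp only [probReal_univ, smul_eq_mul, one_mul]
    rw [← hmD]; ring
  -- (2) 2|∫ a b| ≤ t ∫ a² + t⁻¹ ∫ b²
  have iA2 : Integrable (fun ω => (h (Θ ω) - mh) ^ 2) μ := by
    have := integrable_mul_of_bdd_right hcΘi hcΘi.1 (Eventually.of_forall hcKΘ); simpa [sq] using this
  have iB2 : Integrable (fun ω => (D ω - mD) ^ 2) μ := by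
    have := integrable_mul_of_bdd_right hcDi hcDi.1 hcR; simpa [sq] using this
  have iAB : Integrable (fun ω => (h (Θ ω) - mh) * (D ω - mD)) μ := by
    have := integrable_mul_of_bdd_right hcDi hcΘi.1 (Eventually.of_forall hcKΘ)
    simpa only [mul_comm] using this
  have e2 : 2 * |∫ ω, (h (Θ ω) - mh) * (D ω - mD) ∂μ| ≤
      t * ∫ ω, (h (Θ ω) - mh) ^ 2 ∂μ + t⁻¹ * ∫ ω, (D ω - mD) ^ 2 ∂μ := by
    have hpt : ∀ ω, 2 * |(h (Θ ω) - mh) * (D ω - mD)| ≤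
        t * (h (Θ ω) - mh) ^ 2 + t⁻¹ * (D ω - mD) ^ 2 := fun ω => two_abs_mul_le _ _ ht
    have step1 : |∫ ω, (h (Θ ω) - mh) * (D ω - mD) ∂μ| ≤ ∫ ω, |(h (Θ ω) - mh) * (D ω - mD)| ∂μ :=
      abs_integral_le_integral_abs
    have step2 : ∫ ω, 2 * |(h (Θ ω) - mh) * (D ω - mD)| ∂μ ≤
        ∫ ω, (t * (h (Θ ω) - mh) ^ 2 + t⁻¹ * (D ω - mD) ^ 2) ∂μ :=
      integral_mono ((iAB.abs).const_mul 2) ((iA2.const_mul t).add (iB2.const_mul t⁻¹)) hpt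
    rw [integral_add (iA2.const_mul t) (iB2.const_mul t⁻¹), integral_const_mul, integral_const_mul,
      integral_const_mul] at step2
    linarith
  -- (3) ∫ (h∘Θ − mh)² = Var h
  have e3 : ∫ ω, (h (Θ ω) - mh) ^ 2 ∂μ = (∫ ω, h ω * h ω ∂μ) - (∫ ω, h ω ∂μ) * (∫ ω, h ω ∂μ) := by
    have s := hsub (fun ω => (h ω - mh) ^ 2)
    rw [s]
    have ex : (fun ω => (h ω - mh) ^ 2) = fun ω => h ω * h ω - 2 * mh * h ω + mh ^ 2 := by funext ω; ring
    have i1 : Integrable (fun ω => h ω * h ω) μ :=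
      integrable_mul_of_bdd_right hhi hh.aestronglyMeasurable (Eventually.of_forall hK)
    have i2 : Integrable (fun ω => h ω * h ω - 2 * mh * h ω) μ := i1.sub (hhi.const_mul _)
    rw [ex, integral_add i2 (integrable_const _), integral_sub i1 (hhi.const_mul _), integral_const_mul,
      integral_const]
    simp only [probReal_univ, smul_eq_mul, one_mul]
    rw [← hmh]; ring
  -- (4) ∫ (D − mD)² ≤ ∫ D²
  have e4 : ∫ ω, (D ω - mD) ^ 2 ∂μ ≤ ∫ ω, D ω ^ 2 ∂μ := by
    have ex : (fun ω => (D ω - mD) ^ 2) = fun ω => D ω * D ω - 2 * mD * D ω + mD ^ 2 := by funext ω; ring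
    have i1 : Integrable (fun ω => D ω * D ω) μ := integrable_mul_of_bdd_right hDi hD hR
    have i2 : Integrable (fun ω => D ω * D ω - 2 * mD * D ω) μ := i1.sub (hDi.const_mul _)
    rw [ex, integral_add i2 (integrable_const _), integral_sub i1 (hDi.const_mul _), integral_const_mul,
      integral_const]
    simp only [probReal_univ, smul_eq_mul, one_mul]
    have e5 : ∫ ω, D ω ^ 2 ∂μ = ∫ ω, D ω * D ω ∂μ := by congr 1; funext ω; ring
    rw [e5, ← hmD]; nlinarith [sq_nonneg mD]
  -- combine
  rw [e1]
  have ht' : 0 < t⁻¹ := inv_pos.mpr ht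
  calc 2 * |∫ ω, (h (Θ ω) - mh) * (D ω - mD) ∂μ|
      ≤ t * ∫ ω, (h (Θ ω) - mh) ^ 2 ∂μ + t⁻¹ * ∫ ω, (D ω - mD) ^ 2 ∂μ := e2
    _ ≤ t * ((∫ ω, h ω * h ω ∂μ) - (∫ ω, h ω ∂μ) * (∫ ω, h ω ∂μ)) + t⁻¹ * ∫ ω, D ω ^ 2 ∂μ := by
        rw [e3]; have := mul_le_mul_of_nonneg_left e4 ht'.le; linarith

end Abstract

end Summit.QuantumFields.YangMills.Cruxes.NT.MirrorSplit

end
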